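import Summits.QuantumFields.BalabanUV.Beta.CapRows

/-!
# Beta / CapAnchorBudget — BINDER-OWNERS row CAP-k, item (b): the arithmetic BUDGET of the `k₀ = 0` anchor and a kernel NEGATIVE
# (β sub-cell, DEDICATED row BETA-an5, lineage `b2b-balaban-beta-an5` = OWNER of row CAP-k; gen 19, the lineage's first PROVER seat)

HONEST FRAMING (page 1 of everything the β sub-cell writes): discharging `BetaPertH` makes Bałaban's UV stability UNCONDITIONAL — a
real constructive-QFT result; it is NOT the continuum limit and NOT the Clay problem.  HONEST DEPENDENCY (cell reorg 2026-08-19, verbatim):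
«continuum YM on T⁴ ⇐ BetaPertH ∧ nine spine estimates (0/9 proved); BetaPertH ⇐ (D1) ∧ (D4) ∧ CAP+tail; G-an2-4 gates asym, D1 and NE2/3/4.»
THIS MODULE INSTANTIATES NO BINDER.  It proves, about the anchor row `CapRows.Rows.ofAliasing(L1)` (the shell of row CAP-k item (b)):

 §1 a sup bound the aliasing leaves leave implicit: under strip regularity `StripRegular G κ M` the torus-grid mean of the descended
    integrand is bounded by the same `M` (`‖B4TorusKernel.torusKernel (descendC G h hκ) N 0‖ ≤ M`), hence `0 ≤ M`;
 §2 THE VACUITY LEMMA: whenever the aliasing constant is `≥ 1` (`1 ≤ aliasConstL1 κ N d`, resp. `1 ≤ aliasConst κ N d`) every rational `lo`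
    the leaf can certify is `≤ 0` — the anchor row exists but carries NO positive lower bound, whatever the engines and the (Z2) certification
    deliver;
 §3 WORKED SIZES (closed rational bounds the kernel evaluates, the pattern of `Certified.aliasConstL1_nine_tenths_sixteen_three_le`):
    `1 ≤ aliasConstL1 κ 2 3` for every strip half-width `0 < κ ≤ 1` — so THE ONLY TWO-ENGINE SU(2) TOTAL OF BETA/CERT.md v2.4 (Bloch grid
    n = 2, #56) CAN NEVER ANCHOR the certified road through the ℓ¹ aliasing leaf; and the ℓ¹ budget at the single-engine grids
    `aliasConstL1 (9/10) 8 3 ≤ 1/160`, `aliasConstL1 (9/10) 10 3 ≤ 1/990`, `aliasConstL1 (9/10) 12 3 ≤ 1/5900` (the admissible certified sup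
    bound `M` for a tail budget `τ` is `τ/aliasConstL1`: `M ≤ 48` ∕ `297` ∕ `1770` for `τ = 0.3` at N = 8 ∕ 10 ∕ 12; cap3's N = 16, 20 sizes
    are in `Certified`).

ABSOLUTE RULE (cell charter, verbatim): "No internally-minted statement may enter as a cited fact. Every hypothesis is either
kernel-proved in this package or a verbatim quotation of a PUBLISHED theorem with page reference. The manuscript(s) under audit are
NOT citable for their own disputed steps — they are the thing under adjudication; programme-internal (2001/route/tribunal) claims
are never citable."  Nothing is cited here; every statement is arithmetic or a consequence of the tree's own definitions. [folklore]
-/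

namespace Summit.QuantumFields.BalabanUV.Beta.CapAnchorBudget

open Literature.MathematicalPhysics.QuantumFieldTheory.Balaban1983to89
open Literature.MathematicalPhysics.QuantumFieldTheory.Balaban1983to89.Beta
open B4Strip (ofRealVec Strip)
open B4ContourShift B4TorusKernel UnitAddTorus
open Beta.AliasingTail (aliasRatio aliasConst)
open Beta.AliasingTailL1 (StripRegularC aliasRatioL1 aliasConstL1 aliasRatioL1_lt_one one_add_div_one_sub_mono aliasConstL1_le)
open Beta.Certified (exp_neg_le_inv_sum)
open Summit.QuantumFields.BalabanUV.Beta.CapRows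

/-! ## §1 The grid mean is bounded by the strip bound -/

section SupBound

variable {d : ℕ} {G : (Fin (d + 1) → ℂ) → ℂ} {κ M : ℝ}

/-- Under `StripRegular G κ M` the descended integrand is bounded by `M` at every torus point (the real Brillouin zone lies in the
strip). [folklore] -/
theorem norm_descend_le (h : StripRegular G κ M) (hκ : 0 ≤ κ) (t : UnitAddTorus (Fin (d + 1))) : ‖descend G t‖ ≤ M :=
  h.bound _ (ofRealVec_mem_Strip hκ (two_pi_mul_mem_BZ ⟨fun i => (rep_mem (t i)).1, fun i => (rep_mem (t i)).2.le⟩))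

/-- hence the strip bound is non-negative. [folklore] -/
theorem stripBound_nonneg (h : StripRegular G κ M) (hκ : 0 ≤ κ) : 0 ≤ M :=
  (norm_nonneg _).trans (norm_descend_le h hκ 0)

/-- **The torus-grid mean at `x = 0` is bounded by `M`**: `‖B4TorusKernel.torusKernel (descendC G h hκ) N 0‖ ≤ M` (`N ≥ 1`). [folklore] -/
theorem norm_torusKernel_descend_zero_le (h : StripRegular G κ M) (hκ : 0 ≤ κ) {N : ℕ} (hN : 1 ≤ N) :
    ‖B4TorusKernel.torusKernel (descendC G h hκ) N 0‖ ≤ M := by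
  have hN0 : (0 : ℝ) < (N : ℝ) := by exact_mod_cast (show 0 < N by omega)
  have hNp : (0 : ℝ) < (N : ℝ) ^ (d + 1) := pow_pos hN0 _
  have hterm : ∀ k : Fin (d + 1) → Fin N, ‖descendC G h hκ (gridPt N k) * mFourier 0 (gridPt N k)‖ ≤ M := by
    intro k
    rw [mFourier_zero, ContinuousMap.one_apply, mul_one, descendC_apply]
    exact norm_descend_le h hκ _
  have hsum : ‖∑ k : Fin (d + 1) → Fin N, descendC G h hκ (gridPt N k) * mFourier 0 (gridPt N k)‖ ≤ (N : ℝ) ^ (d + 1) * M := by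
    calc ‖∑ k : Fin (d + 1) → Fin N, descendC G h hκ (gridPt N k) * mFourier 0 (gridPt N k)‖
        ≤ ∑ k : Fin (d + 1) → Fin N, ‖descendC G h hκ (gridPt N k) * mFourier 0 (gridPt N k)‖ := norm_sum_le _ _
      _ ≤ ∑ _k : Fin (d + 1) → Fin N, M := Finset.sum_le_sum fun k _ => hterm k
      _ = (N : ℝ) ^ (d + 1) * M := by
          rw [Finset.sum_const, Finset.card_univ, Fintype.card_fun, Fintype.card_fin, Fintype.card_fin, nsmul_eq_mul]
          push_cast
          ring
  unfold B4TorusKernel.torusKernel torusSum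
  rw [norm_mul, norm_inv, norm_pow, Complex.norm_natCast]
  calc ((N : ℝ) ^ (d + 1))⁻¹ * ‖∑ k : Fin (d + 1) → Fin N, descendC G h hκ (gridPt N k) * mFourier 0 (gridPt N k)‖
      ≤ ((N : ℝ) ^ (d + 1))⁻¹ * ((N : ℝ) ^ (d + 1) * M) := mul_le_mul_of_nonneg_left hsum (by positivity)
    _ = M := by field_simp

/-- a real `t` within `r` of a complex number `T` is at most `‖T‖ + r`. [folklore] -/
theorem le_norm_add_of_ball {T : ℂ} {t r : ℝ} (hT : ‖T - t‖ ≤ r) : t ≤ ‖T‖ + r := by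
  have h1 : |(T - (t : ℂ)).re| ≤ ‖T - (t : ℂ)‖ := Complex.abs_re_le_norm _
  have h2 : (T - (t : ℂ)).re = T.re - t := by simp
  have h3 : T.re ≤ ‖T‖ := Complex.re_le_norm _
  rw [h2] at h1
  have h4 := (abs_le.mp (h1.trans hT)).1
  linarith

end SupBound

/-! ## §2 The vacuity lemma: an aliasing constant `≥ 1` certifies nothing positive -/

section Vacuity

variable {d : ℕ} {G : (Fin (d + 1) → ℂ) → ℂ} {κ M : ℝ}

/-- **VACUITY, ℓ¹ rate.**  Under the hypotheses of `AliasingTailL1.lo_le_of_aliasing_l1` (the binders of `CapRows.Rows.ofAliasingL1`),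
if `1 ≤ aliasConstL1 κ N d` then the certified `lo` is `≤ 0`: `lo ≤ t − r − A ≤ (M + r) − r − M·aliasConstL1 ≤ 0`. [folklore] -/
theorem lo_nonpos_of_one_le_aliasConstL1 (h : StripRegularC G κ M) (hκ : 0 < κ) {N : ℕ} (hN : 1 ≤ N) {t r : ℝ}
    (hT : ‖B4TorusKernel.torusKernel (descendC G (h.toStripRegular hκ.le) hκ.le) N 0 - t‖ ≤ r)
    {A : ℝ} (hA : M * aliasConstL1 κ N d ≤ A) {lo : ℚ} (hlo : ((lo : ℚ) : ℝ) ≤ t - r - A)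
    (hC : 1 ≤ aliasConstL1 κ N d) : ((lo : ℚ) : ℝ) ≤ 0 := by
  have hM : 0 ≤ M := stripBound_nonneg (h.toStripRegular hκ.le) hκ.le
  have hTM := norm_torusKernel_descend_zero_le (h.toStripRegular hκ.le) hκ.le hN
  have ht : t ≤ M + r := by have := le_norm_add_of_ball hT; linarith
  have hAM : M ≤ A := le_trans (by nlinarith) hA
  linarith

/-- **VACUITY, sup-norm rate.**  The same for `Certified.lo_le_of_aliasing` (the binders of `CapRows.Rows.ofAliasing`) when
`1 ≤ aliasConst κ N d`. [folklore] -/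
theorem lo_nonpos_of_one_le_aliasConst (h : StripRegular G κ M) (hκ : 0 < κ) {N : ℕ} (hN : 1 ≤ N) {t r : ℝ}
    (hT : ‖B4TorusKernel.torusKernel (descendC G h hκ.le) N 0 - t‖ ≤ r)
    {A : ℝ} (hA : M * aliasConst κ N d ≤ A) {lo : ℚ} (hlo : ((lo : ℚ) : ℝ) ≤ t - r - A)
    (hC : 1 ≤ aliasConst κ N d) : ((lo : ℚ) : ℝ) ≤ 0 := by
  have hM : 0 ≤ M := stripBound_nonneg h hκ.le
  have hTM := norm_torusKernel_descend_zero_le h hκ.le hN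
  have ht : t ≤ M + r := by have := le_norm_add_of_ball hT; linarith
  have hAM : M ≤ A := le_trans (by nlinarith) hA
  linarith

/-- Consequently the anchor row built by `CapRows.Rows.ofAliasingL1` has `m ≤ 0` whenever `1 ≤ aliasConstL1 κ N d`: it serves neither
the certified road (`hk₂` then forces `c₀(1 + 4θ) ≤ 0`) nor the margin road with a positive constant. [folklore] -/
theorem ofAliasingL1_m_nonpos {b : ℕ → ℝ} (hb : b 0 = (latticeKernel G 0).re) (h : StripRegularC G κ M) (hκ : 0 < κ)
    {N : ℕ} (hN : 1 ≤ N) {t r : ℝ} (hT : ‖B4TorusKernel.torusKernel (descendC G (h.toStripRegular hκ.le) hκ.le) N 0 - t‖ ≤ r)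
    {A : ℝ} (hA : M * aliasConstL1 κ N d ≤ A) (lo : ℚ) (hlo : ((lo : ℚ) : ℝ) ≤ t - r - A)
    (hC : 1 ≤ aliasConstL1 κ N d) : (((Rows.ofAliasingL1 hb h hκ hN hT hA lo hlo).m : ℚ) : ℝ) ≤ 0 :=
  lo_nonpos_of_one_le_aliasConstL1 h hκ hN hT hA hlo hC

end Vacuity

/-! ## §3 Worked sizes: the grid `N = 2` is vacuous for every strip `κ ≤ 1`; the ℓ¹ budget at `N = 8, 10, 12` -/

section Sizes

/-- `0.135 ≤ e^{−2}` (from `Real.exp_one_lt_d9`: `e² < 2.7182818286² < 7.4 ≤ 1/0.135`; the intermediate `e² < 7.4` is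
`Literature.Analysis.FluidPDE.TaoCarleman.exp_two_lt`, not imported here to keep the import closure inside the β sub-cell). [folklore] -/
theorem exp_neg_two_ge : (0.135 : ℝ) ≤ Real.exp (-2) := by
  have h1 := Real.exp_one_lt_d9
  have h0 := Real.exp_pos 1
  have h2 : Real.exp 2 = Real.exp 1 * Real.exp 1 := by rw [← Real.exp_add]; norm_num
  have h4 : Real.exp 2 < 7.4 := by rw [h2]; nlinarith
  rw [Real.exp_neg, le_inv_comm₀ (by norm_num) (Real.exp_pos 2)]
  linarith

/-- For every strip half-width `0 < κ ≤ 1` the alias ratio at period `N = 2` is at least `0.135`. [folklore] -/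
theorem aliasRatioL1_two_ge {κ : ℝ} (hκ1 : κ ≤ 1) : (0.135 : ℝ) ≤ aliasRatioL1 κ 2 := by
  unfold aliasRatioL1
  refine exp_neg_two_ge.trans (Real.exp_le_exp.mpr ?_)
  push_cast
  linarith

/-- **`N = 2` IS VACUOUS FOR EVERY STRIP `0 < κ ≤ 1`**: `1 ≤ aliasConstL1 κ 2 3` (indeed `≥ 1.96`).  With §2: the only two-engine
SU(2) TOTAL of BETA/CERT.md v2.4 (Bloch grid n = 2) cannot anchor the certified road through the ℓ¹ aliasing leaf, whatever sup
bound `M` a (Z2) certification delivers (the certified zero-free strip of CAP-KERNEL §7 is `κ = 9/10`). [folklore] -/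
theorem one_le_aliasConstL1_two {κ : ℝ} (hκ0 : 0 < κ) (hκ1 : κ ≤ 1) : 1 ≤ aliasConstL1 κ 2 3 := by
  have hρ : (0.135 : ℝ) ≤ aliasRatioL1 κ 2 := aliasRatioL1_two_ge hκ1
  have hρ1 : aliasRatioL1 κ 2 < 1 := aliasRatioL1_lt_one hκ0 (by norm_num)
  have hmono : (1 + (0.135 : ℝ)) / (1 - 0.135) ≤ (1 + aliasRatioL1 κ 2) / (1 - aliasRatioL1 κ 2) :=
    one_add_div_one_sub_mono hρ hρ1
  have hpow : ((1 + (0.135 : ℝ)) / (1 - 0.135)) ^ (3 + 1) ≤ ((1 + aliasRatioL1 κ 2) / (1 - aliasRatioL1 κ 2)) ^ (3 + 1) :=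
    pow_le_pow_left₀ (by norm_num) hmono _
  have hnum : (2 : ℝ) ≤ ((1 + (0.135 : ℝ)) / (1 - 0.135)) ^ (3 + 1) := by norm_num
  unfold aliasConstL1
  linarith

/-- also the sup-norm constant: `1 ≤ aliasConst κ 2 3` for `0 < κ ≤ 1` (indeed `≥ 40`): `aliasConst = e^{−2κ}((3 − ρ)/(1 − ρ))⁴` with
`ρ = e^{−κ/2}`, and already `e^{−2}·3⁴ ≥ 10`. [folklore] -/
theorem one_le_aliasConst_two {κ : ℝ} (hκ0 : 0 < κ) (hκ1 : κ ≤ 1) : 1 ≤ aliasConst κ 2 3 := by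
  unfold aliasConst
  have hρ0 : 0 < aliasRatio κ 2 3 := Real.exp_pos _
  have hρ1 : aliasRatio κ 2 3 < 1 := by
    unfold aliasRatio
    rw [Real.exp_lt_one_iff]
    have : (0 : ℝ) < κ * (2 : ℕ) / (3 + 1) := by positivity
    linarith
  have h3 : (3 : ℝ) ≤ (3 - aliasRatio κ 2 3) / (1 - aliasRatio κ 2 3) := by
    rw [le_div_iff₀ (by linarith)]
    nlinarith
  have h81 : (81 : ℝ) ≤ ((3 - aliasRatio κ 2 3) / (1 - aliasRatio κ 2 3)) ^ (3 + 1) := by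
    have := pow_le_pow_left₀ (by norm_num : (0 : ℝ) ≤ 3) h3 (3 + 1)
    norm_num at this ⊢
    exact this
  have he : (0.135 : ℝ) ≤ Real.exp (-(κ * (2 : ℕ))) := by
    refine exp_neg_two_ge.trans (Real.exp_le_exp.mpr ?_)
    push_cast
    linarith
  nlinarith

/-- ℓ¹ WORKED SIZE at `N = 8` (`κ = 9/10`): `e^{−36/5} ≤ 1/1300`. [folklore] -/
theorem aliasRatioL1_nine_tenths_eight_le : aliasRatioL1 (9 / 10) 8 ≤ 1 / 1300 := by
  unfold aliasRatioL1
  have he : Real.exp (-((9 : ℝ) / 10 * (8 : ℕ))) ≤ (∑ i ∈ Finset.range 30, ((36 : ℝ) / 5) ^ i / (i.factorial : ℝ))⁻¹ := by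
    rw [show ((9 : ℝ) / 10 * (8 : ℕ)) = 36 / 5 by push_cast; norm_num]
    exact exp_neg_le_inv_sum (by norm_num) (by norm_num)
  refine he.trans ?_
  simp only [Finset.sum_range_succ, Finset.sum_range_zero, Nat.factorial]
  norm_num

/-- the closed rational majorant of `aliasConstL1 (9/10) 8 3`: `≤ 1/160` (= 6.25e-3; true value ≈ 5.99e-3; admissible sup bound for a tail budget `0.3`: `M ≤ 48`).
[folklore] -/
theorem aliasConstL1_nine_tenths_eight_three_le : aliasConstL1 (9 / 10) 8 3 ≤ 1 / 160 :=
  (aliasConstL1_le aliasRatioL1_nine_tenths_eight_le (by norm_num)).trans (by norm_num)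

/-- ℓ¹ WORKED SIZE at `N = 10` (`κ = 9/10`): `e^{−9} ≤ 1/8000`. [folklore] -/
theorem aliasRatioL1_nine_tenths_ten_le : aliasRatioL1 (9 / 10) 10 ≤ 1 / 8000 := by
  unfold aliasRatioL1
  have he : Real.exp (-((9 : ℝ) / 10 * (10 : ℕ))) ≤ (∑ i ∈ Finset.range 34, (9 : ℝ) ^ i / (i.factorial : ℝ))⁻¹ := by
    rw [show ((9 : ℝ) / 10 * (10 : ℕ)) = 9 by push_cast; norm_num]
    exact exp_neg_le_inv_sum (by norm_num) (by norm_num)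
  refine he.trans ?_
  simp only [Finset.sum_range_succ, Finset.sum_range_zero, Nat.factorial]
  norm_num

/-- the closed rational majorant of `aliasConstL1 (9/10) 10 3`: `≤ 1/990` (≈ 1.0e-3; `M ≤ 297` for a budget `0.3`). [folklore] -/
theorem aliasConstL1_nine_tenths_ten_three_le : aliasConstL1 (9 / 10) 10 3 ≤ 1 / 990 :=
  (aliasConstL1_le aliasRatioL1_nine_tenths_ten_le (by norm_num)).trans (by norm_num)

/-- ℓ¹ WORKED SIZE at `N = 12` (`κ = 9/10`): `e^{−54/5} ≤ 1/48000`. [folklore] -/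
theorem aliasRatioL1_nine_tenths_twelve_le : aliasRatioL1 (9 / 10) 12 ≤ 1 / 48000 := by
  unfold aliasRatioL1
  have he : Real.exp (-((9 : ℝ) / 10 * (12 : ℕ))) ≤ (∑ i ∈ Finset.range 40, ((54 : ℝ) / 5) ^ i / (i.factorial : ℝ))⁻¹ := by
    rw [show ((9 : ℝ) / 10 * (12 : ℕ)) = 54 / 5 by push_cast; norm_num]
    exact exp_neg_le_inv_sum (by norm_num) (by norm_num)
  refine he.trans ?_
  simp only [Finset.sum_range_succ, Finset.sum_range_zero, Nat.factorial]
  norm_num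

/-- the closed rational majorant of `aliasConstL1 (9/10) 12 3`: `≤ 1/5900` (≈ 1.63e-4; `M ≤ 1 770` for a budget `0.3`, `M ≤ 295` for `0.05`).
[folklore] -/
theorem aliasConstL1_nine_tenths_twelve_three_le : aliasConstL1 (9 / 10) 12 3 ≤ 1 / 5900 :=
  (aliasConstL1_le aliasRatioL1_nine_tenths_twelve_le (by norm_num)).trans (by norm_num)

/-- THE BUDGET INEQUALITY in the form the row uses it: if the tail majorant is taken as `A := M · C` with `aliasConstL1 κ N d ≤ C` and the
certified sup bound satisfies `M ≤ τ / C` (`C > 0`), then `A ≤ τ` — so `lo := t − r − τ` is admissible in `Rows.ofAliasingL1`. [folklore] -/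
theorem tail_le_budget {κ M C τ : ℝ} {N d : ℕ} (hM0 : 0 ≤ M) (hC : aliasConstL1 κ N d ≤ C) (hC0 : 0 < C) (hM : M ≤ τ / C) :
    M * aliasConstL1 κ N d ≤ τ := by
  have h1 : M * aliasConstL1 κ N d ≤ M * C := mul_le_mul_of_nonneg_left hC hM0
  have h2 : M * C ≤ τ := by rwa [le_div_iff₀ hC0] at hM
  linarith

end Sizes

end Summit.QuantumFields.BalabanUV.Beta.CapAnchorBudget
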